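import Literature.NumberTheory.DiophantineGeometry.AbcStewartYu2001PlaceBoundsAnalysis
import Literature.Barriers.ABC.BakerMethodBoundsPlaceBoundsProofs
import Literature.NumberTheory.DiophantineGeometry.MultiplicativeGroupApproximationOfMatveevYu
import HarnessLib

/-!
# Stewart–Yu 2001, Theorem 2 from the place bounds, II: the deduction

`Literature/NumberTheory/DiophantineGeometry/AbcStewartYu2001PlaceBoundsProofs.lean` — proofs
companion (theorems only; no definition, no named fact) of `AbcStewartYu2001.lean`. It PROVES the
named fact `stewartYu2001_thm2` (Stewart–Yu 2001, Theorem 2 [cite: StewartYu2001, Theorem 2]: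
`z < exp(p′ · G^{c log₃ G⋆ / log₂ G})`, `p′ = min{P(x), P(y), P(z)}`) from the SAME three place
bounds from which `Literature.Barriers.ABC.BakerMethodBounds_of_placeBounds`
(`BakerMethodBoundsPlaceBoundsProofs.lean`) derives Theorem 1 — for some `K ≥ 1` and every abc triple
`(a, b, c)`, with `Θ_{uv} = theta K u v 0 = K^{ω(uv)+1} ∏_{q ∣ uv} log q` (`theta_zero_eq`) and
`Y = log max{e, 2 log c}`:

* (∞) `log c − log a < Θ_{bc} · Y`,
* (p ∣ a) `ν_p(a) log p < Θ_{bc} · (p / log p)(log p + Y)` for every prime `p ∣ a`,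
* (p ∣ c) `ν_p(c) log p < Θ_{ab} · (p / log p)(log p + Y)` for every prime `p ∣ c`, when `ab > 1`.

So whatever discharges the hypotheses of the Theorem-1 door discharges Theorem 2 as well
(`stewartYu2001_thm2_of_placeBounds`); in particular Pasten's approximation bound
(`stewartYu2001_thm2_of_approximationBound`) and hence Evertse–Győry's Theorem 4.2.1 over `ℚ` alone
(`stewartYu2001_thm2_of_evertseGyory`: the trust base of `stewartYu2001_thm2` becomes
`{Dioph.evertseGyory_thm_4_2_1_rat}`, without the Shimura-curve input `pasten2024_thm_2_5` on which
the earlier implication `stewartYu2001_thm2_of_pasten2024` rests), equivalently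
(`stewartYu2001_thm2_of_matveev_yu`, via `Dioph.evertseGyory_thm_4_2_1_rat_holds_of`) the two
PRIMARY linear-forms facts `Dioph.matveev2000_linearFormsLog_rat` (archimedean) and
`Literature.Barriers.ABC.yu2007_padicLogForm_rat` (`p`-adic).

## The deduction (the shape reported in [cite: Gyory2008, p. 287 (3.12)–(3.13)])

For a triple with `c > 2` let `G = rad(abc) ≥ 6` (`StewartYu2001.six_le_rad`), `ω = ω(abc)`,
`Π = ∏_{q ∣ abc} log max(4, q)`, `M = K^{ω+1} Π`. The tree's three ROUTES
(`log_lt_route_a_of_placeBounds` for `(a, b, c)` and for the swapped triple `(b, a, c)`,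
`log_lt_route_c_of_placeBounds`) give `log c < Θ · Y · (1 + 3 ∑_{p ∣ u} p)` for each member
`u ∈ {a, b, c}` with the `Θ` of the other two; since `Θ ≤ M` (`theta_zero_le`) and
`∑_{p ∣ u} p ≤ ω P(u)`, `log c < M Y (1 + 3ω) P(u)` (`route_to_member`), hence with the least of the
three `P(u)`: `log c < A · Y`, `A = M (1 + 3ω) p′`. Self-improvement (`lt_two_mul_log_of_lt`:
`X < A log max(e, 2X) ⇒ X < 2A log(4A)`), `log p′ ≤ log G` and `log(4M(1+3ω)) ≤ 4M(1+3ω) − 1` give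
`log c < p′ · 128 M² ω² log G` (`log_lt_pmin_mul_of_routes`); and
`128 M² ω² log G ≤ G^{C log₃ G⋆ / log₂ G}` is `StewartYu2001.absorb` of part I
(`AbcStewartYu2001PlaceBoundsAnalysis.lean`: `ω ≤ 30 log G / log₂ G`, Jensen for `∑ log log q`).
No linear-forms estimate is proved here; the archimedean bound IS used (for the member of least
`P` when it is the smallest of the three), exactly as in the Theorem-1 door.

## References

* [StewartYu2001] C. L. Stewart, K. Yu, *On the abc conjecture, II*, Duke Math. J. 108 (2001),
  169–181 — Theorem 2 (cite-only; typed from the secondaries in `AbcStewartYu2001.lean`).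
* [Gyory2008] K. Győry, Acta Arith. 133 (2008), 281–295 — p. 282 (1.3); p. 287 ("in [45] the
  authors gave a direct proof for (1.4) and (1.3)", (3.12)–(3.13)).
* [Pasten2024] H. Pasten, Invent. Math. 236 (2024), 373–385 — Theorem 2.1, §§4–5 (the place bounds
  `Pasten.arch_bound`, `Pasten.padic_bound_a`, `Pasten.padic_bound_c`).
* [EvertseGyory2015] J.-H. Evertse, K. Győry, *Unit Equations in Diophantine Number Theory*, CUP
  2015 — Theorem 4.2.1.
-/

noncomputable section

open Finset Real
open Literature.Barriers.ABC
open Literature.NumberTheory.DiophantineGeometry.Dioph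
open Literature.NumberTheory.DiophantineGeometry.Pasten

namespace Literature.NumberTheory.DiophantineGeometry

namespace StewartYu2001

/-! ### Self-improvement -/

/-- If `X < A · log max(e, 2X)` with `A ≥ 1`, then `X < 2A log(4A)`
(`log(2X) ≤ log(4A) + 2X/(4A) − 1`). [folklore] -/
private theorem lt_two_mul_log_of_lt {A X : ℝ} (hA : 1 ≤ A)
    (h : X < A * Real.log (max (Real.exp 1) (2 * X))) : X < 2 * A * Real.log (4 * A) := by
  have hA0 : 0 < A := by linarith
  have hlog4A : 1 ≤ Real.log (4 * A) := by
    rw [← Real.log_exp 1]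
    apply Real.log_le_log (Real.exp_pos 1)
    have := Real.exp_one_lt_d9
    linarith
  rcases le_or_gt (2 * X) (Real.exp 1) with hsmall | hbig
  · rw [max_eq_left hsmall, Real.log_exp] at h
    nlinarith [mul_le_mul_of_nonneg_left hlog4A hA0.le]
  · rw [max_eq_right hbig.le] at h
    have hu0 : 0 < 2 * X := lt_trans (Real.exp_pos 1) hbig
    have hkey : Real.log (2 * X) ≤ Real.log (4 * A) + 2 * X / (4 * A) - 1 := by
      have h1 := Real.log_le_sub_one_of_pos (show 0 < 2 * X / (4 * A) by positivity)
      rw [Real.log_div hu0.ne' (by positivity)] at h1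
      linarith
    have h2 : A * Real.log (2 * X) ≤ A * Real.log (4 * A) + X / 2 - A := by
      have h3 := mul_le_mul_of_nonneg_left hkey hA0.le
      have h4 : A * (Real.log (4 * A) + 2 * X / (4 * A) - 1) =
          A * Real.log (4 * A) + X / 2 - A := by
        field_simp
        ring
      linarith [h4]
    linarith

/-! ### The per-triple deduction from the three route outputs -/

section Core

variable {K : ℝ}

/-- `0 < log max(4, q)`. [folklore] -/
private theorem log_max_four_pos (q : ℕ) : 0 < Real.log ((max 4 q : ℕ) : ℝ) :=
  Real.log_pos (by exact_mod_cast lt_of_lt_of_le (by norm_num : 1 < 4) (le_max_left 4 q))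

/-- `1 ≤ log max(4, q)`. [folklore] -/
private theorem one_le_log_max_four (q : ℕ) : 1 ≤ Real.log ((max 4 q : ℕ) : ℝ) := by
  rw [← Real.log_exp 1]
  apply Real.log_le_log (Real.exp_pos 1)
  have h4 : (4 : ℝ) ≤ ((max 4 q : ℕ) : ℝ) := by exact_mod_cast le_max_left 4 q
  have := Real.exp_one_lt_d9
  linarith

/-- `Θ_{uv} = theta K u v 0 = K^{ω(uv)+1} ∏_{q ∣ uv} log q` is at most
`K^{ω(n)+1} ∏_{q ∣ n} log max(4, q)` whenever `uv ∣ n` (`u, v` coprime and non-zero, `n ≠ 0`,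
`K ≥ 1`). [folklore] -/
private theorem theta_zero_le (hK : 1 ≤ K) {u v n : ℕ} (hu : u ≠ 0) (hv : v ≠ 0) (huv : u.Coprime v)
    (hn : n ≠ 0) (hdvd : u * v ∣ n) :
    theta K u v 0 ≤
      K ^ (n.primeFactors.card + 1) * ∏ q ∈ n.primeFactors, Real.log ((max 4 q : ℕ) : ℝ) := by
  rw [theta_zero_eq K hu hv huv]
  have hsub : (u * v).primeFactors ⊆ n.primeFactors := Nat.primeFactors_mono hdvd hn
  have hK0 : 0 ≤ K := by linarith
  have h1 : K ^ ((u * v).primeFactors.card + 1) ≤ K ^ (n.primeFactors.card + 1) :=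
    pow_le_pow_right₀ hK (by have := Finset.card_le_card hsub; omega)
  have hlog0 : ∀ q ∈ (u * v).primeFactors, 0 ≤ Real.log (q : ℝ) := fun q hq =>
    Real.log_nonneg (by exact_mod_cast (Nat.prime_of_mem_primeFactors hq).one_lt.le)
  have h2 : ∏ q ∈ (u * v).primeFactors, Real.log (q : ℝ) ≤
      ∏ q ∈ (u * v).primeFactors, Real.log ((max 4 q : ℕ) : ℝ) := by
    apply Finset.prod_le_prod hlog0
    intro q hq
    have hq0 : (0 : ℝ) < q := by exact_mod_cast (Nat.prime_of_mem_primeFactors hq).pos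
    exact Real.log_le_log hq0 (by exact_mod_cast le_max_right 4 q)
  have h3 : ∏ q ∈ (u * v).primeFactors, Real.log ((max 4 q : ℕ) : ℝ) ≤
      ∏ q ∈ n.primeFactors, Real.log ((max 4 q : ℕ) : ℝ) :=
    Finset.prod_le_prod_of_subset_of_one_le hsub (fun q _ => (log_max_four_pos q).le)
      fun q _ _ => one_le_log_max_four q
  exact mul_le_mul h1 (h2.trans h3) (Finset.prod_nonneg hlog0) (pow_nonneg hK0 _)

/-- From a route output `X < Θ · Y · (1 + 3 ∑_{p ∣ u} p)` with `Θ ≤ M`, `M ≥ 0`, `Y ≥ 1` and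
`u ∣ n ≠ 0`: `X < M · Y · ((1 + 3 ω(n)) · P(u))` (`∑_{p ∣ u} p ≤ ω(u) P(u) ≤ ω(n) P(u)`,
`P(u) ≥ 1`). [folklore] -/
private theorem route_to_member {Θ M Y X : ℝ} {u n : ℕ}
    (hX : X < Θ * Y * (1 + 3 * ∑ p ∈ u.primeFactors, (p : ℝ)))
    (hΘM : Θ ≤ M) (hM : 0 ≤ M) (hY : 1 ≤ Y) (hn : n ≠ 0) (hun : u ∣ n) :
    X < M * Y * ((1 + 3 * (n.primeFactors.card : ℝ)) * largestPrimeFactor u) := by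
  have hsub : u.primeFactors ⊆ n.primeFactors := Nat.primeFactors_mono hun hn
  have hP1 : (1 : ℝ) ≤ largestPrimeFactor u := by exact_mod_cast one_le_largestPrimeFactor u
  have hsum : ∑ p ∈ u.primeFactors, (p : ℝ) ≤ n.primeFactors.card * largestPrimeFactor u := by
    have h1 : ∑ p ∈ u.primeFactors, (p : ℝ) ≤ u.primeFactors.card • (largestPrimeFactor u : ℝ) :=
      Finset.sum_le_card_nsmul _ _ _ fun p hp => by
        exact_mod_cast le_largestPrimeFactor_of_mem_primeFactors hp
    rw [nsmul_eq_mul] at h1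
    have h2 : (u.primeFactors.card : ℝ) ≤ n.primeFactors.card := by
      exact_mod_cast Finset.card_le_card hsub
    nlinarith
  have hS0 : 0 ≤ 1 + 3 * ∑ p ∈ u.primeFactors, (p : ℝ) := by positivity
  have h3 : 1 + 3 * ∑ p ∈ u.primeFactors, (p : ℝ) ≤
      (1 + 3 * (n.primeFactors.card : ℝ)) * largestPrimeFactor u := by
    nlinarith
  calc X < Θ * Y * (1 + 3 * ∑ p ∈ u.primeFactors, (p : ℝ)) := hX
    _ ≤ M * Y * (1 + 3 * ∑ p ∈ u.primeFactors, (p : ℝ)) :=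
        mul_le_mul_of_nonneg_right (mul_le_mul_of_nonneg_right hΘM (by linarith)) hS0
    _ ≤ M * Y * ((1 + 3 * (n.primeFactors.card : ℝ)) * largestPrimeFactor u) :=
        mul_le_mul_of_nonneg_left h3 (by positivity)

/-- **The per-triple deduction.** For an abc triple with `c > 2` and `K ≥ 1`, the three route
outputs `log c < Θ_{bc} Y (1 + 3∑_{p∣a} p)`, `log c < Θ_{ac} Y (1 + 3∑_{p∣b} p)`,
`log c < Θ_{ab} Y (1 + 3∑_{p∣c} p)` (`Y = log max{e, 2 log c}`) give
`log c < p′ · 128 M² ω² log G` with `p′ = min{P(a), P(b), P(c)}`, `G = rad(abc)`, `ω = ω(abc)`,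
`M = K^{ω+1} ∏_{q ∣ abc} log max(4, q)`: each route gives `log c < M Y (1 + 3ω) P(u)`, so
`log c < A · Y` with `A = M (1+3ω) p′`; self-improvement (`lt_two_mul_log_of_lt`) gives
`log c < 2A log(4A)`, and `log p′ ≤ log G`, `log(4M(1+3ω)) ≤ 4M(1+3ω) − 1`.
[cite: StewartYu2001, Theorem 2 (deduction)] [cite: Gyory2008, p. 287 (3.12)] -/
theorem log_lt_pmin_mul_of_routes (hK : 1 ≤ K) {a b c : ℕ} (h : IsABCTriple a b c) (hc : 2 < c)
    (hA : Real.log c < theta K b c 0 * Real.log (max (Real.exp 1) (2 * Real.log c)) *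
      (1 + 3 * ∑ p ∈ a.primeFactors, (p : ℝ)))
    (hB : Real.log c < theta K a c 0 * Real.log (max (Real.exp 1) (2 * Real.log c)) *
      (1 + 3 * ∑ p ∈ b.primeFactors, (p : ℝ)))
    (hC : Real.log c < theta K a b 0 * Real.log (max (Real.exp 1) (2 * Real.log c)) *
      (1 + 3 * ∑ p ∈ c.primeFactors, (p : ℝ))) :
    Real.log c < pmin a b c *
      (128 * (K ^ ((a * b * c).primeFactors.card + 1) *
          ∏ q ∈ (a * b * c).primeFactors, Real.log ((max 4 q : ℕ) : ℝ)) ^ 2 *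
        ((a * b * c).primeFactors.card : ℝ) ^ 2 * Real.log (rad a b c : ℕ)) := by
  obtain ⟨ha, hb, habc, hcop⟩ := id h
  have hc0 : c ≠ 0 := by omega
  have habc0 : a * b * c ≠ 0 := by positivity
  have hbc : b.Coprime c := coprime_right_of_isABCTriple h
  have hac : a.Coprime c := coprime_left_of_isABCTriple h
  have hdvd_bc : b * c ∣ a * b * c := Dvd.intro_left a (by ring)
  have hdvd_ac : a * c ∣ a * b * c := Dvd.intro b (by ring)
  have hdvd_ab : a * b ∣ a * b * c := Dvd.intro c rfl
  have hdvd_a : a ∣ a * b * c := Dvd.intro (b * c) (by ring)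
  have hdvd_b : b ∣ a * b * c := Dvd.intro (a * c) (by ring)
  have hdvd_c : c ∣ a * b * c := Dvd.intro_left (a * b) rfl
  have hK0 : 0 < K := by linarith
  set PL := ∏ q ∈ (a * b * c).primeFactors, Real.log ((max 4 q : ℕ) : ℝ) with hPLdef
  set M := K ^ ((a * b * c).primeFactors.card + 1) * PL with hMdef
  set Y := Real.log (max (Real.exp 1) (2 * Real.log c)) with hYdef
  set L := Real.log (rad a b c : ℕ) with hLdef
  set T := 1 + 3 * ((a * b * c).primeFactors.card : ℝ) with hTdef
  have hPL1 : 1 ≤ PL := one_le_prod_log_max_four _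
  have hM1 : 1 ≤ M := one_le_mul_of_one_le_of_one_le (one_le_pow₀ hK) hPL1
  have hMpos : 0 < M := by linarith
  have hY1 : 1 ≤ Y := one_le_log_max_exp _
  -- `Θ ≤ M` for the three pairs
  have hΘa : theta K b c 0 ≤ M := theta_zero_le hK hb.ne' hc0 hbc habc0 hdvd_bc
  have hΘb : theta K a c 0 ≤ M := theta_zero_le hK ha.ne' hc0 hac habc0 hdvd_ac
  have hΘc : theta K a b 0 ≤ M := theta_zero_le hK ha.ne' hb.ne' hcop habc0 hdvd_ab
  -- the three members
  have hma : Real.log c < M * Y * (T * largestPrimeFactor a) :=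
    route_to_member hA hΘa hMpos.le hY1 habc0 hdvd_a
  have hmb : Real.log c < M * Y * (T * largestPrimeFactor b) :=
    route_to_member hB hΘb hMpos.le hY1 habc0 hdvd_b
  have hmc : Real.log c < M * Y * (T * largestPrimeFactor c) :=
    route_to_member hC hΘc hMpos.le hY1 habc0 hdvd_c
  -- the least of the three greatest prime factors
  have hmin : Real.log c < M * Y * (T * (pmin a b c : ℝ)) := by
    rw [pmin_def]
    rcases min_choice (largestPrimeFactor a) (min (largestPrimeFactor b) (largestPrimeFactor c))
      with h1 | h1
    · rw [h1]; exact hma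
    · rw [h1]
      rcases min_choice (largestPrimeFactor b) (largestPrimeFactor c) with h2 | h2
      · rw [h2]; exact hmb
      · rw [h2]; exact hmc
  -- self-improvement with `A = M T p′`
  have hω1 : (1 : ℝ) ≤ (a * b * c).primeFactors.card := by
    have hab1 : 1 ≤ a * b := Nat.mul_pos ha hb
    have h1 : 1 < a * b * c :=
      lt_of_lt_of_le (by omega : 1 < c) (Nat.le_mul_of_pos_left c hab1)
    exact_mod_cast Finset.card_pos.mpr (Nat.nonempty_primeFactors.mpr h1)
  have hT4 : 4 ≤ T := by rw [hTdef]; linarith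
  have hTpos : 0 < T := by linarith
  have hp1 : (1 : ℝ) ≤ pmin a b c := by exact_mod_cast one_le_pmin a b c
  have hppos : (0 : ℝ) < pmin a b c := by linarith
  set A := M * T * (pmin a b c : ℝ) with hAdef
  have hA1 : 1 ≤ A :=
    one_le_mul_of_one_le_of_one_le (one_le_mul_of_one_le_of_one_le hM1 (by linarith)) hp1
  have hA0 : 0 < A := by linarith
  have hXA : Real.log c < A * Y := by
    have : A * Y = M * Y * (T * (pmin a b c : ℝ)) := by rw [hAdef]; ring
    rw [this]; exact hmin
  have hSI : Real.log c < 2 * A * Real.log (4 * A) := lt_two_mul_log_of_lt hA1 hXA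
  -- `log(4A) ≤ 4MT − 1 + L`
  have hrad6 : (6 : ℝ) ≤ (rad a b c : ℝ) := by exact_mod_cast six_le_rad h hc
  have hL1 : 1 < L := by
    rw [hLdef, Real.lt_log_iff_exp_lt (by linarith)]
    have := Real.exp_one_lt_d9
    linarith
  have hpminle : (pmin a b c : ℝ) ≤ (rad a b c : ℝ) := by
    have hcne : c.primeFactors.Nonempty := Nat.nonempty_primeFactors.mpr (by omega)
    have hPc := largestPrimeFactor_mem hcne
    have hPc' : largestPrimeFactor c ≤ rad a b c :=
      prime_le_rad (Nat.prime_of_mem_primeFactors hPc)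
        ((Nat.dvd_of_mem_primeFactors hPc).trans hdvd_c) habc0
    have h1 : pmin a b c ≤ largestPrimeFactor c := by
      rw [pmin_def]; exact (min_le_right _ _).trans (min_le_right _ _)
    exact_mod_cast h1.trans hPc'
  have hlogp : Real.log (pmin a b c : ℝ) ≤ L := Real.log_le_log hppos hpminle
  have hlog4A : Real.log (4 * A) ≤ 4 * M * T - 1 + L := by
    have hsplit : 4 * A = (4 * M * T) * (pmin a b c : ℝ) := by rw [hAdef]; ring
    have h47 : (0 : ℝ) < 4 * M * T := by positivity
    rw [hsplit, Real.log_mul h47.ne' hppos.ne']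
    have := Real.log_le_sub_one_of_pos h47
    linarith
  have hstep : 4 * M * T - 1 + L ≤ 4 * M * T * L := by
    have h0 : (1 : ℝ) * 4 ≤ M * T := mul_le_mul hM1 hT4 (by norm_num) hMpos.le
    have h1 : (1 : ℝ) ≤ 4 * M * T := by linarith
    linarith [mul_nonneg (sub_nonneg.mpr h1) (sub_nonneg.mpr hL1.le)]
  have hT0 : 0 ≤ T := hTpos.le
  have hTω : T ≤ 4 * (a * b * c).primeFactors.card := by rw [hTdef]; linarith
  have hL0 : 0 ≤ L := by linarith
  calc Real.log c < 2 * A * Real.log (4 * A) := hSI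
    _ ≤ 2 * A * (4 * M * T * L) := mul_le_mul_of_nonneg_left (hlog4A.trans hstep) (by linarith)
    _ = (pmin a b c : ℝ) * (8 * M ^ 2 * T ^ 2 * L) := by rw [hAdef]; ring
    _ ≤ (pmin a b c : ℝ) * (8 * M ^ 2 * (4 * (a * b * c).primeFactors.card) ^ 2 * L) := by
        apply mul_le_mul_of_nonneg_left _ hppos.le
        apply mul_le_mul_of_nonneg_right _ hL0
        apply mul_le_mul_of_nonneg_left _ (by positivity)
        exact pow_le_pow_left₀ hT0 hTω 2
    _ = (pmin a b c : ℝ) * (128 * M ^ 2 * ((a * b * c).primeFactors.card : ℝ) ^ 2 * L) := by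
        ring

end Core

/-! ### Theorem 2 from the three place bounds -/

/-- **Stewart–Yu 2001, Theorem 2, from the three place bounds.** Suppose that for some `K ≥ 1`
and every abc triple `(a, b, c)`: (∞) `log c − log a < Θ_{bc} · Y`; (p ∣ a)
`ν_p(a) log p < Θ_{bc} · (p / log p)(log p + Y)` for every prime `p ∣ a`; and, when `ab > 1`,
(p ∣ c) `ν_p(c) log p < Θ_{ab} · (p / log p)(log p + Y)` for every prime `p ∣ c` — where
`Θ_{uv} = theta K u v 0 = K^{ω(uv)+1} ∏_{q ∣ uv} log q` and `Y = log max{e, 2 log c}`; these are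
EXACTLY the hypotheses of `Literature.Barriers.ABC.BakerMethodBounds_of_placeBounds` (Theorem 1
from the place bounds). Then `stewartYu2001_thm2`:
`z < exp(p′ · G^{C log₃ G⋆ / log₂ G})` for all coprime positive `x + y = z`, `z > 2`.
Assembly: the tree's three routes (`log_lt_route_a_of_placeBounds` for `(a,b,c)` and `(b,a,c)`,
`log_lt_route_c_of_placeBounds`), `log_lt_pmin_mul_of_routes`, `absorb`.
[cite: StewartYu2001, Theorem 2] [cite: Gyory2008, p. 282 (1.3), p. 287] -/
theorem stewartYu2001_thm2_of_placeBounds {K : ℝ} (hK : 1 ≤ K)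
    (harch : ∀ {a b c : ℕ}, IsABCTriple a b c →
      Real.log c - Real.log a < theta K b c 0 * Real.log (max (Real.exp 1) (2 * Real.log c)))
    (hpad : ∀ {a b c : ℕ}, IsABCTriple a b c → ∀ {p : ℕ}, p.Prime → p ∣ a →
      (a.factorization p : ℝ) * Real.log p < theta K b c 0 *
        ((p / Real.log p) * (Real.log p + Real.log (max (Real.exp 1) (2 * Real.log c)))))
    (hpadc : ∀ {a b c : ℕ}, IsABCTriple a b c → 1 < a * b → ∀ {p : ℕ}, p.Prime → p ∣ c →
      (c.factorization p : ℝ) * Real.log p < theta K a b 0 *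
        ((p / Real.log p) * (Real.log p + Real.log (max (Real.exp 1) (2 * Real.log c))))) :
    stewartYu2001_thm2 := by
  obtain ⟨C, hC, habs⟩ := absorb hK
  rw [stewartYu2001_thm2_iff]
  refine ⟨C, hC, fun a b c h hc => ?_⟩
  obtain ⟨ha, hb, habc, hcop⟩ := id h
  have hc0 : (0 : ℝ) < c := by exact_mod_cast (show 0 < c by omega)
  rw [← Real.log_lt_iff_lt_exp hc0]
  have hab : 1 < a * b := by
    by_contra hle
    push Not at hle
    have hab1 : a * b = 1 := by have := Nat.mul_pos ha hb; omega
    have ha1 := Nat.eq_one_of_mul_eq_one_right hab1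
    have hb1 := Nat.eq_one_of_mul_eq_one_left hab1
    omega
  have hA := log_lt_route_a_of_placeBounds hK h (harch h) (hpad h)
  have hB := log_lt_route_a_of_placeBounds hK h.swap (harch h.swap) (hpad h.swap)
  have hCc := log_lt_route_c_of_placeBounds hK h (hpadc h hab)
  have hcore := log_lt_pmin_mul_of_routes hK h hc hA hB hCc
  have habc0 : a * b * c ≠ 0 := by positivity
  have hrad : ((rad a b c : ℕ) : ℝ) = ∏ q ∈ (a * b * c).primeFactors, (q : ℝ) := by
    rw [rad_def, Nat.radical_eq_prod_primeFactors]; push_cast; rfl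
  have h6 : (6 : ℝ) ≤ ∏ q ∈ (a * b * c).primeFactors, (q : ℝ) := by
    rw [← hrad]; exact_mod_cast six_le_rad h hc
  have hQ := habs _ (fun q hq => Nat.prime_of_mem_primeFactors hq) h6
  rw [← hrad] at hQ
  exact hcore.trans_le (mul_le_mul_of_nonneg_left hQ (Nat.cast_nonneg _))

/-- **Theorem 2 from ANY approximation bound of Pasten's shape** (`PastenApproximationBound K`,
`K ≥ 1` — Pasten 2024, Theorem 2.1 quantifies over all finite families of non-torsion rational
generators; the three place bounds are its instances `Pasten.arch_bound`, `Pasten.padic_bound_a`,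
`Pasten.padic_bound_c` at threshold `N = 0`). [cite: StewartYu2001, Theorem 2]
[cite: Pasten2024, Theorem 2.1] -/
theorem stewartYu2001_thm2_of_approximationBound {K : ℝ} (hK : 1 ≤ K)
    (hP : PastenApproximationBound K) : stewartYu2001_thm2 :=
  stewartYu2001_thm2_of_placeBounds hK (fun h => arch_bound hK hP h 0)
    (fun h => fun hp hpa => padic_bound_a hK hP h 0 hp hpa)
    (fun h h1 => fun hp hpc => padic_bound_c hK hP h h1 0 hp hpc)

/-- **Theorem 2 from Evertse–Győry's Theorem 4.2.1 over `ℚ`** (Matveev 2000 + Yu 2007, the named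
fact `Dioph.evertseGyory_thm_4_2_1_rat`, which gives `PastenApproximationBound pastenK` by
`Dioph.pasten2024_thm_2_1`). So the trust base of `stewartYu2001_thm2` in the tree is
`{evertseGyory_thm_4_2_1_rat}` — no Shimura-curve input (compare
`stewartYu2001_thm2_of_pasten2024`, whose hypothesis `pasten2024_thm_1_4_2` rests on Theorem 4.2.1
AND Pasten's Theorem 2.5). [cite: StewartYu2001, Theorem 2] [cite: EvertseGyory2015, Thm 4.2.1] -/
theorem stewartYu2001_thm2_of_evertseGyory (hEG : evertseGyory_thm_4_2_1_rat) :
    stewartYu2001_thm2 :=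
  stewartYu2001_thm2_of_approximationBound one_le_pastenK (pasten2024_thm_2_1 hEG)

/-- **Theorem 2 from the two primary linear-forms estimates over `ℚ`** — Matveev 2000 (Cor. 2.3,
as Evertse–Győry Thm. 3.2.4, the named fact `Dioph.matveev2000_linearFormsLog_rat`) at the
archimedean place and Yu 2007 (as Evertse–Győry Thm. 3.2.7, the named fact
`Literature.Barriers.ABC.yu2007_padicLogForm_rat`) at the finite places — through the tree's proof
of Evertse–Győry Thm. 4.2.1 from them (`Dioph.evertseGyory_thm_4_2_1_rat_holds_of`). These two are
the inputs of the Baker-method proof of the theorem (Stewart–Yu use Baker–Wüstholz 1993 and Yu's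
`p`-adic estimates; any estimates of this quality give the statement, the constant `c` being
unspecified). [cite: StewartYu2001, Theorem 2] [cite: EvertseGyory2015, Thm 3.2.4, Thm 3.2.7] -/
theorem stewartYu2001_thm2_of_matveev_yu (hM : matveev2000_linearFormsLog_rat)
    (hY : yu2007_padicLogForm_rat) : stewartYu2001_thm2 :=
  stewartYu2001_thm2_of_evertseGyory (evertseGyory_thm_4_2_1_rat_holds_of hM hY)

end StewartYu2001

end Literature.NumberTheory.DiophantineGeometry

end
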